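import Literature.Algebra.EuclideanLattices.MRIncGDDSolver
import HarnessLib

/-!
# One run of the procedure `W` of MR07 Thm. 5.23 on the fine grid: abort unless `z` solves `SIS′`, and the non-abort probability — proved

Topic `Algebra/EuclideanLattices` (family `pqc`). Micciancio–Regev 2007, proof of Thm. 5.23, step (2)
(authors' version p. 29): "`W(B, S)`: run the sampling procedure `m` times …, the combining procedure
with `F` …; abort unless `z` is an `SIS′` solution; output `w = x − Yz ∈ L(B)*`". On the fine grid
this is the experiment of `MRIncGDDIdealised.lean` with ZERO shifts (`tᵢ = 0`), whose `output` (with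
target `0`) is exactly `x − Yz`, post-processed by the abort rule. This file defines that run as a
`PMF (Option Λ)` and bounds its abort probability:

* `wRun` — the run (definition with body): `some (x − Yz)` if `IsSolution' A β z` (and the output is a
  lattice vector, which it is on the support), `none` otherwise;
* `map_experiment_az_eq` — the law of the pair `(A, z)` under `experiment` is
  `(law A) ≫= (A ↦ (A, O A))`;
* `toReal_wRun_none_le` — **`Pr[abort] ≤ 1 − (δ′ − m · 2ε/(1+ε))`** where
  `δ′ = Pr_{A ∼ U, z ∼ O(A)}[IsSolution' A β z]` (MR07 p. 30: "the success probability of `W` is at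
  least `δ − mε/2 > δ/2`"), by kernel contraction and `tvDist_query_le`.

## References

* D. Micciancio, O. Regev, *Worst-case to average-case reductions based on Gaussian measures*,
  SIAM J. Comput. 37 (2007) 267–302; authors' version, proof of Thm. 5.23, pp. 29–30.
-/

noncomputable section

open Finset Module Submodule

namespace Literature.Algebra.EuclideanLattices

namespace MicciancioRegev2007

section WRun

open scoped ENNReal Classical Real
open MeasureTheory PMF Literature.Probability.Distributions Literature.Computability.Cryptography
  Literature.Computability.Cryptography.SIS

variable {V : Type*} [NormedAddCommGroup V] [InnerProductSpace ℝ V] [FiniteDimensional ℝ V]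
  [MeasurableSpace V] [BorelSpace V]
variable {n : ℕ} (b : Basis (Fin n) ℝ V) (q d : ℕ) [NeZero q] [NeZero d]
variable (L : Submodule ℤ V) [DiscreteTopology L] [IsZLattice ℝ L]
variable (rep : (Fin n → ZMod (q * d)) ⧸ gridImage b (q * d) L → span ℤ (Set.range b))
variable {m : ℕ}

/-- **One run of `W(B, S)`** (MR07 Thm. 5.23, step (2)) on the fine grid: the idealised experiment with
zero shifts; keep `w = x − Yz` iff `z` is an `SIS′` solution of the query (and `w` is a lattice
vector — automatic on the support, recorded to type the output in `Λ`).
[cite: MicciancioRegev2007, Thm. 5.23 (proof, step (2), p. 29)] -/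
def wRun (hSL : ∀ j, ((q * d : ℕ) : ℝ) • b j ∈ L) (hrep : ∀ a, gridClass b (q * d) L (rep a) = a)
    (O : Matrix (Fin n) (Fin m) (ZMod q) → PMF (Fin m → ℤ)) (s β : ℝ) : PMF (Option L) :=
  (experiment b q d L rep hSL hrep O s (fun _ => (0 : V))).map fun ω =>
    if h : IsSolution' ω.1.2.1 β ω.1.2.2 ∧ output b q d L rep ω ∈ L then some ⟨_, h.2⟩ else none

omit [MeasurableSpace V] [BorelSpace V] [IsZLattice ℝ L] in
/-- **The law of `(A, z)` under the experiment** is the query law followed by the oracle pairing.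
[folklore] -/
theorem map_experiment_az_eq (hSL : ∀ j, ((q * d : ℕ) : ℝ) • b j ∈ L)
    (hrep : ∀ a, gridClass b (q * d) L (rep a) = a) (O : Matrix (Fin n) (Fin m) (ZMod q) → PMF (Fin m → ℤ))
    (s : ℝ) (tv : Fin m → V) :
    (experiment b q d L rep hSL hrep O s tv).map (fun ω => ω.1.2) =
      (((indepLaw m fun i => offsetLaw b q d L rep hSL hrep s (tv i)).bind fun cbar =>
          (PMF.uniformOfFintype (Fin m → (QuotientAddGroup.mk' (gridImage b (q * d) L)).ker)).map
            (Prod.mk cbar)).bind fun ch => PMF.pure (queryMatrix b q d L rep ch.1 ch.2)).bind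
        fun A => (O A).map (Prod.mk A) := by
  rw [experiment, PMF.map_bind]
  conv_rhs => rw [PMF.bind_bind]
  refine congrArg (PMF.bind _) (funext fun ch => ?_)
  rw [PMF.map_bind]
  -- the `y`-stage is integrated out
  have h : ∀ y : Fin m → L,
      (((PMF.pure (queryMatrix b q d L rep ch.1 ch.2)).bind fun A => (O A).map (Prod.mk A)).map
          fun az => ((ch, az), y)).map (fun ω => ω.1.2) =
        (PMF.pure (queryMatrix b q d L rep ch.1 ch.2)).bind fun A => (O A).map (Prod.mk A) := by
    intro y
    rw [PMF.map_comp]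
    exact PMF.map_id _
  simp_rw [h]
  exact PMF.bind_const _ _

/-- **The abort probability of one run of `W`** (MR07 p. 30: "the success probability of `W` is at
least `δ − mε/2`", on the grid with `m · 2ε/(1+ε)`): for `0 < ε`, `0 < s`, `η_ε(L) ≤ s`, `L ⊆ L'`,
`Pr[wRun = none] ≤ 1 − (δ′ − m · 2ε/(1+ε))`, `δ′ = Pr_{A ∼ U, z ∼ O(A)}[IsSolution' A β z]`.
[cite: MicciancioRegev2007, Thm. 5.23 (proof, p. 30)] -/
theorem toReal_wRun_none_le (hSL : ∀ j, ((q * d : ℕ) : ℝ) • b j ∈ L)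
    (hrep : ∀ a, gridClass b (q * d) L (rep a) = a) (hLL' : L ≤ span ℤ (Set.range b))
    (O : Matrix (Fin n) (Fin m) (ZMod q) → PMF (Fin m → ℤ)) {ε s : ℝ} (hε : 0 < ε) (hs : 0 < s)
    (hηs : smoothingParameter L ε ≤ s) (β : ℝ) :
    ((wRun b q d L rep hSL hrep O s β) none).toReal ≤
      1 - ((((PMF.uniformOfFintype (Matrix (Fin n) (Fin m) (ZMod q))).bind fun A =>
              (O A).map (Prod.mk A)).toOuterMeasure {az | IsSolution' az.1 β az.2}).toReal -
            m * (2 * ε / (1 + ε))) := by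
  -- `none` is one minus the mass of `IsSolution' ∧ output ∈ L`
  rw [wRun, toReal_map_dite_none]
  set E := experiment b q d L rep hSL hrep O s (fun _ => (0 : V)) with hE
  -- on the support, `IsSolution'` already gives `output ∈ L`
  have hsub : {ω | IsSolution' ω.1.2.1 β ω.1.2.2} ∩ E.support ⊆
      {ω | IsSolution' ω.1.2.1 β ω.1.2.2 ∧ output b q d L rep ω ∈ L} := by
    rintro ⟨⟨⟨cbar, hv⟩, ⟨A, z⟩⟩, y⟩ ⟨hsol, hmem⟩
    refine ⟨hsol, ?_⟩
    have hA : A = queryMatrix b q d L rep cbar hv := query_eq_of_mem_support b q d L rep hSL hrep O s _ hmem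
    simp only [Set.mem_setOf_eq] at hsol
    subst hA
    have hxL : combineOutput b q d L rep cbar hv z ∈ L :=
      combine_mem_grid b L q d hSL (fun i => rep (cbar i))
        (fun i => (QuotientAddGroup.ker_mk' (gridImage b (q * d) L)).le (hv i).2)
        (dvd_of_queryMatrix_mulVec_eq_zero b q d L rep cbar hv hsol.2.1)
    change combineOutput b q d L rep cbar hv z - ∑ i, (z i : ℝ) • ((y i : L) : V) ∈ L
    refine L.sub_mem hxL (Submodule.sum_mem _ fun i _ => ?_)
    rw [Int.cast_smul_eq_zsmul]
    exact L.smul_mem (z i) (y i).2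
  have h1 : (E.toOuterMeasure {ω | IsSolution' ω.1.2.1 β ω.1.2.2}).toReal ≤
      (E.toOuterMeasure {ω | IsSolution' ω.1.2.1 β ω.1.2.2 ∧ output b q d L rep ω ∈ L}).toReal :=
    ENNReal.toReal_mono (PMF.toOuterMeasure_ne_top _ _) (E.toOuterMeasure_mono hsub)
  -- the `(A, z)`-marginal
  have hmarg : (E.toOuterMeasure {ω | IsSolution' ω.1.2.1 β ω.1.2.2}).toReal =
      ((E.map fun ω => ω.1.2).toOuterMeasure {az | IsSolution' az.1 β az.2}).toReal := by
    rw [PMF.toOuterMeasure_map_apply]; rfl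
  rw [hE, map_experiment_az_eq] at hmarg
  rw [← hE] at hmarg
  -- kernel contraction against the uniform query, and eq. (13)
  set μA := ((indepLaw m fun i => offsetLaw b q d L rep hSL hrep s 0).bind fun cbar =>
      (PMF.uniformOfFintype (Fin m → (QuotientAddGroup.mk' (gridImage b (q * d) L)).ker)).map
        (Prod.mk cbar)).bind fun ch => PMF.pure (queryMatrix b q d L rep ch.1 ch.2) with hμA
  have h3 := (abs_le.1 (PMF.abs_toReal_toOuterMeasure_bind_sub_le_tvDist μA
    (PMF.uniformOfFintype (Matrix (Fin n) (Fin m) (ZMod q))) (fun A => (O A).map (Prod.mk A))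
    {az | IsSolution' az.1 β az.2})).1
  have h4 := tvDist_query_le b q d L rep hSL hrep hLL' hε hs hηs (fun _ : Fin m => (0 : V))
  beta_reduce at h4
  rw [← hμA] at h4
  linarith

end WRun

end MicciancioRegev2007

end Literature.Algebra.EuclideanLattices

end
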